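import Literature.Combinatorics.SimpleGraph.TriangleFreeLocalCut
import HarnessLib

/-!
# The threshold rule is the best one-round cut algorithm for `d = 2, 3, 4` (HRSS 2017, §2.5)

Source. J. Hirvonen, J. Rybicki, S. Schmid, J. Suomela, *Large cuts with local algorithms on
triangle-free graphs*, Electron. J. Combin. 24(4) (2017) P4.21 = arXiv:1402.2543
[HirvonenRybickiSchmidSuomela2017] (held text p0004–p0005). §2.5: “finding a good algorithm …
for large cuts in `d`-regular triangle-free graphs … is now [reduced to] … a heavy cut … in the
weighted neighbourhood graph `𝒩`. … For `d = 3`, the heaviest cut `𝒜_opt` of `𝒩` is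
`𝒜_opt((k,i)) = k` if `i < 3`, `= k̄` if `i ≥ 3` (4). This is also the best possible algorithm for
this value of `d`, for the model of computing that we defined in Section 2.2. … we reduced the
max-weight-cut instance `𝒩` to a max-weight-SAT instance … we can solve the cases `d = 2, 3, …, 32`
very quickly … Surprisingly, in all cases the max-weight cut has the following simple structure:
`𝒜_opt((k,i)) = k` if `i < τ`, `= k̄` if `i ≥ τ` (5) for some threshold `τ`”; §2.6: the optimal
thresholds `τ_d` (`τ_2 = 2`, `τ_3 = τ_4 = 3`).

Rendering. The model of §2.2 — one uniformly random bit per node, one communication round, output a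
function `𝒜 : V_𝒩 → {a,b}` of the local view `(k, i)` — is the tree's `Rule Unit` of
`Literature.Combinatorics.SimpleGraph.TriangleFreeLocalCut` (rules WITHOUT private randomness), whose
Lemma 2 `expCutCount_eq` gives `𝔼[#cut(𝒜)] = |E| · w_𝒩(𝒜)` on every `d`-regular triangle-free
graph. The paper's max-SAT computation is replaced, for `d = 2, 3, 4`, by a kernel enumeration of all
`2^{2d+2}` cuts of `𝒩` in exact integer arithmetic (`4^d · w_𝒩`): `ngraphWeightZ_le_two/three/four`
(`decide +kernel`; `d = 4` has `1024` cuts). HONEST FRAMING: instance-level adjudication of specific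
advantage claims; no claim about BQP vs BPP or the summit — these are statements about one model of
ONE-ROUND classical algorithms (deterministic given one random bit per node); they say nothing about
other classical algorithms.

What is here: `viewWeightZ`, `ngraphWeightZ`, `table` (integer bookkeeping),
**`ngraphWeight_eq_tableZ`** (`w_𝒩(𝒜) = ngraphWeightZ(table 𝒜)/4^d` for deterministic rules), the
kernel certificates `ngraphWeightZ_le_two` (`≤ 12`), **`ngraphWeightZ_le_three`** (`≤ 44`),
`ngraphWeightZ_le_four` (`≤ 164`) and `ngraphWeightZ_threshold` (the thresholds attain them), the
real forms `ngraphWeight_le_two/three/four` (`w_𝒩(𝒜) ≤ 3/4, 11/16, 41/64`), the graph-level bounds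
`expCutCount_le_two/three/four` and the optimality statements
**`expCutCount_le_expCutCount_threshold_two/three/four`** (`𝔼[#cut(𝒜)] ≤ 𝔼[#cut(𝒜_{τ_d})]` for
every deterministic one-round rule `𝒜` on every triangle-free `d`-regular graph, `d = 2, 3, 4`),
plus `alpha_three_four` (`α(3,4) = 41/64`).

NOT formalised: `d ≥ 5` (`d = 5` would be `4096` cuts; the paper's SAT computation reaches
`d = 32`); rules WITH private randomness (a multilinearity argument reduces them to deterministic
ones; not carried out here); the uniqueness of the optimal cut.
-/

noncomputable section

namespace Literature.Combinatorics.SimpleGraph.TriangleFreeLocalCutOptimal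

open Finset Literature.Combinatorics.SimpleGraph.TriangleFreeLocalCut

variable {V : Type*} [Fintype V] [DecidableEq V] (G : SimpleGraph V) [DecidableRel G.Adj]

/-- Integer edge weights `4^d · w_𝒩(N₁, N₂)` of the neighbourhood graph. [cite:
HirvonenRybickiSchmidSuomela2017, §2.3 (definition of w_𝒩)] -/
def viewWeightZ (d : ℕ) (N₁ N₂ : Bool × ℕ) : ℕ :=
  if N₁.1 = N₂.1 then choosePred (d - 1) N₁.2 * choosePred (d - 1) N₂.2
  else (d - 1).choose N₁.2 * (d - 1).choose N₂.2

/-- `4^d · w_𝒩(𝒜)` for a DETERMINISTIC one-round rule given as a table `f k i` on the `2d + 2`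
views `(k, i)`, `i ≤ d` (a cut of the neighbourhood graph). [cite: HirvonenRybickiSchmidSuomela2017,
§2.3–§2.4 (“a cut 𝒜 : V_𝒩 → {a,b} of weight w_𝒩(𝒜)”)] -/
def ngraphWeightZ (d : ℕ) (f : Bool → Fin (d + 1) → Bool) : ℕ :=
  ∑ k₁ : Bool, ∑ i₁ : Fin (d + 1), ∑ k₂ : Bool, ∑ i₂ : Fin (d + 1),
    if f k₁ i₁ ≠ f k₂ i₂ then viewWeightZ d (k₁, (i₁ : ℕ)) (k₂, (i₂ : ℕ)) else 0

/-- The table of a deterministic rule on the views `(k, i)`, `i ≤ d`. [cite: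
HirvonenRybickiSchmidSuomela2017, §2.2 (“𝒜 : V_𝒩 → {a, b}”)] -/
def table (d : ℕ) (A : Rule Unit) : Bool → Fin (d + 1) → Bool := fun k i => A (k, (i : ℕ)) ()

/-- `w_𝒩(N₁,N₂) = viewWeightZ / 4^d`. [cite: HirvonenRybickiSchmidSuomela2017, §2.3] -/
private theorem viewWeight_eq (d : ℕ) (N₁ N₂ : Bool × ℕ) :
    viewWeight d N₁ N₂ = (viewWeightZ d N₁ N₂ : ℝ) / 4 ^ d := by
  unfold viewWeight viewWeightZ
  split_ifs <;> rfl

/-- For a deterministic rule the disagreement probability is the indicator. [cite: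
HirvonenRybickiSchmidSuomela2017, §2.4 (“Σ_{𝒜(N₁) ≠ 𝒜(N₂)}”)] -/
private theorem disagree_unit (A : Rule Unit) (N₁ N₂ : Bool × ℕ) :
    disagree A N₁ N₂ = if A N₁ () ≠ A N₂ () then 1 else 0 := by
  unfold disagree
  simp

/-- **`w_𝒩(𝒜) = ngraphWeightZ(table 𝒜) / 4^d`**: the cut weight of a deterministic rule is the
integer table sum (kernel-evaluable). [cite: HirvonenRybickiSchmidSuomela2017, §2.4 Lemma 2] -/
theorem ngraphWeight_eq_tableZ (d : ℕ) (A : Rule Unit) :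
    ngraphWeight d A = (ngraphWeightZ d (table d A) : ℝ) / 4 ^ d := by
  unfold ngraphWeight ngraphWeightZ table views
  rw [Nat.cast_sum, sum_div, sum_product]
  refine sum_congr rfl fun k₁ _ => ?_
  rw [Nat.cast_sum, sum_div, ← Fin.sum_univ_eq_sum_range (fun i₁ => ∑ N₂ ∈ univ ×ˢ range (d + 1),
    viewWeight d (k₁, i₁) N₂ * disagree A (k₁, i₁) N₂)]
  refine sum_congr rfl fun i₁ _ => ?_
  rw [Nat.cast_sum, sum_div, sum_product]
  refine sum_congr rfl fun k₂ _ => ?_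
  rw [Nat.cast_sum, sum_div, ← Fin.sum_univ_eq_sum_range (fun i₂ =>
    viewWeight d (k₁, (i₁ : ℕ)) (k₂, i₂) * disagree A (k₁, (i₁ : ℕ)) (k₂, i₂))]
  refine sum_congr rfl fun i₂ _ => ?_
  rw [viewWeight_eq, disagree_unit]
  split_ifs <;> simp

/-- Kernel check, `d = 2`: every cut of `𝒩` has `4² · w_𝒩 ≤ 12`, i.e. `w_𝒩 ≤ 3/4 = α(2,2)`.
[cite: HirvonenRybickiSchmidSuomela2017, §2.5 (“we can solve the cases d = 2, 3, …, 32 … in all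
cases the max-weight cut has the following simple structure”)] -/
theorem ngraphWeightZ_le_two : ∀ f : Bool → Fin 3 → Bool, ngraphWeightZ 2 f ≤ 12 := by
  decide +kernel

/-- Kernel check, `d = 3`: every cut of `𝒩` has `4³ · w_𝒩 ≤ 44`, i.e. `w_𝒩 ≤ 11/16 = α(3,3)`
(“For d = 3, the heaviest cut 𝒜_opt of 𝒩 is [𝒜_3] … This is also the best possible algorithm
for this value of d, for the model of computing that we defined”). [cite:
HirvonenRybickiSchmidSuomela2017, §2.5 eq. (4) and the sentence after it] -/
theorem ngraphWeightZ_le_three : ∀ f : Bool → Fin 4 → Bool, ngraphWeightZ 3 f ≤ 44 := by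
  decide +kernel

/-- Kernel check, `d = 4`: `4⁴ · w_𝒩 ≤ 164`, i.e. `w_𝒩 ≤ 41/64 = α(3,4)`. [cite:
HirvonenRybickiSchmidSuomela2017, §2.5 (“in all cases the max-weight cut has the following simple
structure”)] -/
theorem ngraphWeightZ_le_four : ∀ f : Bool → Fin 5 → Bool, ngraphWeightZ 4 f ≤ 164 := by
  decide +kernel

/-- The thresholds attain the maxima: `4^d · w_𝒩(𝒜_{τ_d}) = 12, 44, 164` for `d = 2, 3, 4`
(`τ₂ = 2`, `τ₃ = τ₄ = 3`). [cite: HirvonenRybickiSchmidSuomela2017, §2.5 eq. (4) (d = 3) and §2.6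
(“𝒜_τ … τ_d”)] -/
theorem ngraphWeightZ_threshold :
    ngraphWeightZ 2 (table 2 (thresholdRule 2)) = 12 ∧ ngraphWeightZ 3 (table 3 (thresholdRule 3)) = 44 ∧
      ngraphWeightZ 4 (table 4 (thresholdRule 3)) = 164 := by
  refine ⟨?_, ?_, ?_⟩ <;> decide +kernel

/-- **HRSS §2.5, `d = 3`: `𝒜_3` is the best one-round algorithm of the model** — every
deterministic one-round rule `𝒜 : V_𝒩 → {a,b}` has `w_𝒩(𝒜) ≤ w_𝒩(𝒜_3) = 11/16`. [cite:
HirvonenRybickiSchmidSuomela2017, §2.5 (“This is also the best possible algorithm for this value of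
d, for the model of computing that we defined”)] -/
theorem ngraphWeight_le_three (A : Rule Unit) : ngraphWeight 3 A ≤ 11 / 16 := by
  rw [ngraphWeight_eq_tableZ, div_le_iff₀ (by positivity)]
  have h' : (ngraphWeightZ 3 (table 3 A) : ℝ) ≤ 44 := by exact_mod_cast ngraphWeightZ_le_three _
  linarith

/-- `d = 2`: every deterministic one-round rule has `w_𝒩(𝒜) ≤ 3/4 = w_𝒩(𝒜_2)`. [cite:
HirvonenRybickiSchmidSuomela2017, §2.5 (“we can solve the cases d = 2, 3, …, 32”)] -/
theorem ngraphWeight_le_two (A : Rule Unit) : ngraphWeight 2 A ≤ 3 / 4 := by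
  rw [ngraphWeight_eq_tableZ, div_le_iff₀ (by positivity)]
  have h' : (ngraphWeightZ 2 (table 2 A) : ℝ) ≤ 12 := by exact_mod_cast ngraphWeightZ_le_two _
  linarith

/-- `d = 4`: every deterministic one-round rule has `w_𝒩(𝒜) ≤ 41/64 = w_𝒩(𝒜_3) = α(3,4)`. [cite:
HirvonenRybickiSchmidSuomela2017, §2.5 (“in all cases the max-weight cut has the following simple
structure”)] -/
theorem ngraphWeight_le_four (A : Rule Unit) : ngraphWeight 4 A ≤ 41 / 64 := by
  rw [ngraphWeight_eq_tableZ, div_le_iff₀ (by positivity)]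
  have h' : (ngraphWeightZ 4 (table 4 A) : ℝ) ≤ 164 := by exact_mod_cast ngraphWeightZ_le_four _
  linarith

/-- **Graph level, `d = 3`**: on every triangle-free `3`-regular graph, EVERY deterministic
one-round rule cuts at most `11/16 · |E|` edges in expectation — the value attained by `𝒜_3`
(`expCutCount_threshold`, `alpha_three`). [cite: HirvonenRybickiSchmidSuomela2017, §2.5 (optimality
of 𝒜_3 for d = 3) with §2.4 Lemma 2] -/
theorem expCutCount_le_three (hreg : G.IsRegularOfDegree 3) (hG : G.CliqueFree 3) (A : Rule Unit) :
    expCutCount G A ≤ #G.edgeFinset * (11 / 16) := by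
  rw [expCutCount_eq G hreg hG]
  exact mul_le_mul_of_nonneg_left (ngraphWeight_le_three A) (Nat.cast_nonneg _)

/-- **Optimality of `𝒜_3` at `d = 3`, graph level**: `𝔼[#cut(𝒜)] ≤ 𝔼[#cut(𝒜_3)]` for every
deterministic one-round rule on every triangle-free `3`-regular graph. [cite:
HirvonenRybickiSchmidSuomela2017, §2.5 (“the best possible algorithm for this value of d”)] -/
theorem expCutCount_le_expCutCount_threshold_three (hreg : G.IsRegularOfDegree 3)
    (hG : G.CliqueFree 3) (A : Rule Unit) :
    expCutCount G A ≤ expCutCount G (thresholdRule 3) := by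
  rw [expCutCount_threshold G (by norm_num) hreg hG (by norm_num), alpha_three]
  exact expCutCount_le_three G hreg hG A

/-- Graph level, `d = 2`: every deterministic one-round rule cuts at most `¾ |E|` edges in
expectation on a triangle-free `2`-regular graph. [cite: HirvonenRybickiSchmidSuomela2017, §2.5] -/
theorem expCutCount_le_two (hreg : G.IsRegularOfDegree 2) (hG : G.CliqueFree 3) (A : Rule Unit) :
    expCutCount G A ≤ #G.edgeFinset * (3 / 4) := by
  rw [expCutCount_eq G hreg hG]
  exact mul_le_mul_of_nonneg_left (ngraphWeight_le_two A) (Nat.cast_nonneg _)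

/-- Graph level, `d = 4`: every deterministic one-round rule cuts at most `41/64 · |E|` edges in
expectation on a triangle-free `4`-regular graph. [cite: HirvonenRybickiSchmidSuomela2017, §2.5] -/
theorem expCutCount_le_four (hreg : G.IsRegularOfDegree 4) (hG : G.CliqueFree 3) (A : Rule Unit) :
    expCutCount G A ≤ #G.edgeFinset * (41 / 64) := by
  rw [expCutCount_eq G hreg hG]
  exact mul_le_mul_of_nonneg_left (ngraphWeight_le_four A) (Nat.cast_nonneg _)

/-- `α(3,4) = 41/64`. [cite: HirvonenRybickiSchmidSuomela2017, §2.6 Lemma 3] -/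
theorem alpha_three_four : alpha 3 4 = 41 / 64 := by
  have h : alphaNum 3 4 = 9 := by decide
  rw [alpha_eq_alphaNum, h]
  norm_num

/-- **Optimality of `𝒜_3` at `d = 4`, graph level**: `𝔼[#cut(𝒜)] ≤ 𝔼[#cut(𝒜_3)]` for every
deterministic one-round rule on every triangle-free `4`-regular graph. [cite:
HirvonenRybickiSchmidSuomela2017, §2.5 (“in all cases the max-weight cut has the following simple
structure”) and §2.6 (τ_4 = 3)] -/
theorem expCutCount_le_expCutCount_threshold_four (hreg : G.IsRegularOfDegree 4)
    (hG : G.CliqueFree 3) (A : Rule Unit) :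
    expCutCount G A ≤ expCutCount G (thresholdRule 3) := by
  rw [expCutCount_threshold G (by norm_num) hreg hG (by norm_num), alpha_three_four]
  exact expCutCount_le_four G hreg hG A

/-- **Optimality of `𝒜_2` at `d = 2`, graph level.** [cite: HirvonenRybickiSchmidSuomela2017, §2.5
and §2.6 (τ_2 = 2)] -/
theorem expCutCount_le_expCutCount_threshold_two (hreg : G.IsRegularOfDegree 2)
    (hG : G.CliqueFree 3) (A : Rule Unit) :
    expCutCount G A ≤ expCutCount G (thresholdRule 2) := by
  rw [expCutCount_threshold G (by norm_num) hreg hG (by norm_num), alpha_two]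
  exact expCutCount_le_two G hreg hG A

end Literature.Combinatorics.SimpleGraph.TriangleFreeLocalCutOptimal
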